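/-
COR-CM (cells pub-hodgecm / pub-hodgecm2, stage 2 of the Hodge ladder) — Δ2 BRIDGE, COORDINATOR «Δ2 RESTRUCTURE FOR SPEED» 2026-08-23,
sublemma **S1** of the CM-side contract `hcm` (skeleton `HOME/d2bridge/HcmSkeleton.lean`, assembled `CorCM/D2Bridge/HcmPieces.lean`, fields
`dLiu ∕ admLiu` of `HcmPieces`): «[Liu 2021] Def. 4.5 (2) ⇒ LIU'S OWN CM datum `D_μ` is ADMISSIBLE», i.e. reads as a model CM record
`LiuCMSide` whose type is the INFLATED REFLEX TYPE of `(E, Φ_μ)`.  Seat prover-pub-hodgecm2-d2bridge-prove-1-g0-0 (d2bridge-prove-1).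
THIS FILE is the HOLE-FREE CORE of S1: it produces, from item6-p1's AS-PRINTED typing `Def45.CMDatum` of one object `D_μ ∈ 𝒜(μ)` and Liu's
eigenclass `α`, EVERY field value of the record `dLiu` together with the two laws the assembly consumes (`α_mem`; the generator identity
behind S4's `geom_eq`).  The record itself (`HodgeCM.Model.LiuCMSide`, `Model/Binders/JLiuCommonReflexOfCMData.lean`) and its admissibility
predicate `IsReflexOfTypeG` (`Model/Binders/JLiuCornerOfReflex.lean`) sit behind the port's L38 hole today (`Model.Universe` →
`Model/EndStatePerLAxioms_2`); the ≈ 30-line pin instance `dLiu q := ⟨K*, Ψ*, M_μ, e_μ, B, ιB, θB, Ψ̃_μ, …, (q : ℂ) • α'⟩`,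
`admLiu q := isReflexOfType_of_reflexCMType … (RingEquiv.refl _) …` (✔ `Transposition/Item6PinMatchReflexPairPkg.lean`, R2) follows the burst.
Theorems only: no definition, no instance, no named fact, no `variable`; nothing landed is edited or restated.  FRAMING: HC_CM is NOT proved;
«Δ2 BRIDGE CLOSED» is NOT claimed; no binder of any END display is touched.
-/
import Summits.HodgeConjecture.CorCM.B01.Transposition.Item6PinMatchDef45Principal
import Summits.HodgeConjecture.CorCM.B01.Transposition.Item6PinMatchDef45BC
import Summits.HodgeConjecture.HodgeCM.CM.CommonReflexSpan_1
import Literature.AlgebraicGeometry.ComplexMultiplication.ShimuraInflationBettiJunctions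
import HarnessLib

set_option autoImplicit false

/-!
# Δ2 bridge, S1: Liu's own CM datum `D_μ` read as an admissible model record — the hole-free core

[Liu2021] Def. 4.5 (2) (`FJcycle.tex` l. 1944–1951), VERBATIM (the part consumed): «We define a *CM data for `μ`* to be a quadruple
`D_μ = (A_μ, i_μ, λ_μ, r_μ)`, in which • `A_μ` is an abelian variety over `E`, • `i_μ : M_μ → End_E(A_μ)_ℚ` is a CM structure such that – for
every `x ∈ M_μ`, the determinant of the action of `i_μ(x)` on the `E`-vector space `Lie_E(A_μ)` equals `η_μ(x)`, …»; Def. 4.3 (2) (l. 1919):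
«`M'_μ ⊆ ℂ` the reflex field of `(E, Φ_μ)`, with the induced CM type `Ψ_μ`»; §4.1 l. 1928: «`M_μ` … a number field containing `M'_μ`»; proof of
Thm. 4.18, l. 2250: «the maximal subspace of `H¹_{B,τ'}(A_μ, ℂ)` over which `M_μ` acts via the inclusion `M_μ ↪ ℂ` has dimension `1`.  We
choose a basis `α` of this subspace».

WHAT THE MODEL RECORD ASKS (`HodgeCM.Model.LiuCMSide`, fields `K' Φ' M k A ιA θA ΦA hΦA isRealisation τ α α_mem`; admissibility
`adm μ d := d.IsReflexOfTypeG ι₁ Φ_μ` = «`(d.K', d.Φ')` is the reflex pair of `(L, Φ_μ)` read through `ι₁`, `d.τ ∘ d.k = ι₁ ∘ incl`»): an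
abelian variety `A/ℂ` with an INTEGRAL `𝓞_M`-multiplication `ιA` realising ON `H¹` a CM type `ΦA` of `M` that is the inflation along
`k : K' → M` of `Φ'`, and a `τ`-eigenclass `α ∈ ℂ ⊗ H¹(A; ℚ)`.  Liu's `i_μ` is RATIONAL (`End_E(A_μ)_ℚ`), so the record's abelian variety is the
PRINCIPAL MODEL `B` of `A_μ ⊗_{E,ι₁} ℂ` in its isogeny class (Shimura 1998 §7.1 Prop. 7: an isogeny pair `(u, v, m)`, `𝓞_{M_μ}` acting on `B`
through the transported structure), which the tree's `Model.exists_principal_isCMTypeRealisation_baseChange_of_det45`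
(`Transposition/Item6PinMatchDef45Principal.lean`, ✔) supplies FROM DEF. 4.5 (2)'s FIRST BULLET with the CM type
`Ψ̃_μ := inducedCMType e_μ (reflexCMType ι₁ Φ_μ id)` — THE INFLATED REFLEX TYPE — the Hodge `(1,0)`/cotangent comparison and the base change of
the cotangent space being the tree theorems `cotangent_hodge10_comparison_holds`, `det_cotangentMap_baseChange_law` (✔ `Item6PinMatchDef45BC`).

WHAT THIS FILE PROVES (`Summit.HodgeConjecture.CorCM.D2Bridge`):
* §1 `baseChange_pull_pull_of_comp_eq_nsmul`, `baseChange_pull_comp_transport` — bookkeeping on `ℂ ⊗_ℚ H¹(−(ℂ); ℚ)` along an isogeny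
  pair: `u^*(v^* x) = m • x`, and for the transported class `α' := m⁻¹ • v^* α₀` the GENERATOR IDENTITY `(f ≫ u)^* α' = f^* α₀` for EVERY
  `ℂ`-morphism `f : Y ⟶ A` of schemes (functoriality of Betti `H¹`; no inverse on `H¹` is used);
* §2 `exists_liuCMRecord_of_cmDatum` — **S1, hole-free core**: for `L/ℚ` Galois CM (the guard of `IsReflexOfTypeG`), the pin `ι₁`, a
  conjugate-symplectic weight-one `μ`, ONE object `X : Def45.CMDatum (AlgHom.id ℚ L) ι₁ hμ hw Car` of [Liu2021] Def. 4.5 (2) AS PRINTED and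
  Liu's eigenclass `α₀ ∈ ℂ ⊗ H¹(A_μ ⊗_{E,ι₁} ℂ; ℚ)` («`M_μ` acts via the inclusion `M_μ ↪ ℂ`», `α₀ ≠ 0`): there are `B`, an ISOGENY
  `u : A_μ ⊗ ℂ ⟶ B`, `ιB : 𝓞_{M_μ} → End B`, `θB`, a proof `hB : IsCMTypeRealisation Ψ̃_μ B ιB θB` and a class `α' ∈ ℂ ⊗ H¹(B; ℚ)` with
  `α'` a NON-ZERO eigenclass, for the inclusion `M_μ ⊆ ℂ`, of the complexified rational CM action `complexify (cmAction θB _)` (EXACTLY the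
  `α_mem` clause of `LiuCMSide`, in its own currency) and `(f ≫ u)^* α' = f^* α₀` for every `f : Y ⟶ A_μ ⊗ ℂ` (the law behind S4's
  `geom_eq`: at the pin `Mor (dLiu q) = (P_Γ ⟶ B)`, `f_of φ := f_φ ≫ u`, and `geom (dLiu q) (f_of φ) = q • f_φ^* α₀` — a statement on LIU'S
  OWN `A_μ ⊗ ℂ`).  With `K' := reflexField ℚ L (algValuedIn ι₁ Φ_μ)`, `Φ' := (reflexCMType ι₁ Φ_μ id).1`, `M := M_μ`, `k := e_μ = Def45.incl`,
  `τ := (M_μ ⊆ ℂ)`, `hΦA := mem_inducedCMType_iff`, these are ALL the fields of `dLiu`, and `admLiu` is R2 (`isReflexOfType_of_reflexCMType`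
  at `e := RingEquiv.refl`, `Def45.coe_incl`).

READING / STRENGTH.  Nothing printed is altered or assumed: the inputs are the as-printed record `Def45.CMDatum` (whose inhabitation is
[Liu2021] Prop. 4.6 (1), the displays' `hObj`/`h46`) and Liu's chosen `α` (l. 2250; at the pin the class behind `Map43RationalData.α`).
Unconditional (no named fact): `hW`, `hdetBC` of p301919 are discharged by name.  NOT claimed: that `LiuCMSide`/`dLiu` elaborate today
(port-gated); HC_CM.

References: Y. Liu, *Fourier–Jacobi cycles and arithmetic relative trace formula*, Camb. J. Math. 9 (2021) = arXiv:2102.11518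
(`FJcycle.tex` md5 6db49a74122d): §4.1 l. 1928, Def. 4.3 (2) l. 1919, Def. 4.5 ll. 1936–1964, Prop. 4.6 (1) l. 1969, proof of Thm. 4.18
l. 2246–2253; G. Shimura, *Abelian Varieties with Complex Multiplication and Modular Functions* (1998) §5.2, §7.1 Prop. 7, §8.3 Prop. 28;
D. Mumford, *Abelian Varieties* (1970) §19.
-/

noncomputable section

open scoped TensorProduct

namespace Summit.HodgeConjecture.CorCM.D2Bridge

open CategoryTheory NumberField
open Literature.AlgebraicGeometry.Motives Literature.AlgebraicGeometry.HodgeTheory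
open Literature.AlgebraicGeometry.ComplexMultiplication Literature.AlgebraicGeometry.Milne1999
open Literature.AlgebraicGeometry.Motives.AbelianVariety
open Literature.NumberTheory.ComplexMultiplication Literature.NumberTheory.Automorphic
open Literature.NumberTheory.Automorphic.IdeleClassGroup Literature.NumberTheory.Automorphic.PicardCM
open Literature.NumberTheory.Automorphic.Liu2021
open Summit.HodgeConjecture.CorCM.Model

/-! ## §1 Bookkeeping on `ℂ ⊗_ℚ H¹(−(ℂ); ℚ)` along an isogeny pair -/

section Transport

variable {A B : AbelianVariety ℂ} {u : A ⟶ B} {v : B ⟶ A} {m : ℕ}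

/-- `u^*(v^* x) = m • x` on `ℂ ⊗_ℚ H¹(A(ℂ); ℚ)` when `u ≫ v = m • 𝟙 A` (`[m]^* = m` on `H¹`). [cite: MumfordAV1970, §19 Remark p. 169] -/
theorem baseChange_pull_pull_of_comp_eq_nsmul (huv : u ≫ v = m • 𝟙 A) (x : ℂ ⊗[ℚ] bettiCohomology A.X 1) :
    (BettiUniverse.pull u.hom.hom.hom 1).baseChange ℂ ((BettiUniverse.pull v.hom.hom.hom 1).baseChange ℂ x) = (m : ℂ) • x := by
  have hcomp : BettiUniverse.pull u.hom.hom.hom 1 ∘ₗ BettiUniverse.pull v.hom.hom.hom 1 = (m : ℚ) • LinearMap.id := by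
    rw [← BettiUniverse.pull_comp, show u.hom.hom.hom ≫ v.hom.hom.hom = (u ≫ v).hom.hom.hom from rfl, huv]
    change (bettiCohomology.map (m • 𝟙 A : A ⟶ A).hom.hom.hom 1).hom = _
    rw [bettiCohomology_map_nsmul_id_one, ModuleCat.hom_nsmul, ModuleCat.hom_id, Nat.cast_smul_eq_nsmul]
  rw [← LinearMap.comp_apply, ← LinearMap.baseChange_comp, hcomp, LinearMap.baseChange_smul, LinearMap.baseChange_id,
    LinearMap.smul_apply, LinearMap.id_apply, Nat.cast_smul_eq_nsmul, Nat.cast_smul_eq_nsmul]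

/-- **The generator identity in the pin's currency.**  For an isogeny pair (`u ≫ v = m • 𝟙 A`, `0 < m`) and the transported class
`α' := m⁻¹ • v^* α₀ ∈ ℂ ⊗_ℚ H¹(B(ℂ); ℚ)`: `(f ≫ u)^* α' = f^* α₀` for EVERY morphism of `ℂ`-schemes `f : Y ⟶ A` (functoriality of `H¹`).
[cite: MumfordAV1970, §19 Remark p. 169] -/
theorem baseChange_pull_comp_transport (hm : 0 < m) (huv : u ≫ v = m • 𝟙 A) (α₀ : ℂ ⊗[ℚ] bettiCohomology A.X 1)
    {Y : SchemeOver ℂ} (f : Y ⟶ A.X) :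
    (BettiUniverse.pull (f ≫ u.hom.hom.hom) 1).baseChange ℂ
        (((m : ℂ)⁻¹) • (BettiUniverse.pull v.hom.hom.hom 1).baseChange ℂ α₀) =
      (BettiUniverse.pull f 1).baseChange ℂ α₀ := by
  have hm' : (m : ℂ) ≠ 0 := Nat.cast_ne_zero.2 hm.ne'
  rw [BettiUniverse.pull_comp, LinearMap.baseChange_comp, LinearMap.comp_apply, map_smul,
    baseChange_pull_pull_of_comp_eq_nsmul huv, smul_smul, inv_mul_cancel₀ hm', one_smul]

end Transport

/-! ## §2 S1, hole-free core: every field of `dLiu` and its two laws, from `Def45.CMDatum` and Liu's `α` -/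

/-- **S1 — LIU'S OWN CM DATUM READ AS AN ADMISSIBLE MODEL RECORD (hole-free core).**  For a CM field `L` Galois over `ℚ`, the pin
`ι₁ : L → ℂ`, a conjugate-symplectic `μ` of weight one, ONE object `X = (A_μ, i_μ, λ_μ, r_μ)` of [Liu2021] Def. 4.5 (2) AS PRINTED
(`Def45.CMDatum`: `A_μ/L` REAL, `i_μ : M_μ → End⁰(A_μ)` RATIONAL with `[M_μ:ℚ] = 2 dim A_μ` and the FIRST BULLET on `Lie^∨`), and Liu's
eigenclass `α₀ ∈ ℂ ⊗ H¹(A_μ ⊗_{L,ι₁} ℂ; ℚ)` on which `M_μ` acts through `i_μ` «via the inclusion `M_μ ↪ ℂ`» (l. 2250), `α₀ ≠ 0`: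
there are a complex abelian variety `B`, an ISOGENY `u : A_μ ⊗_{L,ι₁} ℂ ⟶ B`, an integral `ιB : 𝓞_{M_μ} → End B`, `θB` with
`hB : IsCMTypeRealisation Ψ̃_μ B ιB θB` for THE INFLATED REFLEX TYPE `Ψ̃_μ = inducedCMType e_μ (reflexCMType ι₁ Φ_μ id)`
(`e_μ = Def45.incl` : `M'_μ ⊆ M_μ`, l. 1928), and `α' ∈ ℂ ⊗ H¹(B; ℚ)`, such that `α'` is a NON-ZERO eigenclass for `M_μ ⊆ ℂ` of the
complexified rational action `complexify (cmAction θB hB.isInducedOnIntegers)` — the `α_mem` clause of `LiuCMSide` verbatim — and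
`(f ≫ u)^* α' = f^* α₀` for every `ℂ`-morphism `f : Y ⟶ A_μ ⊗ ℂ`.  KERNEL: `exists_principal_isCMTypeRealisation_baseChange_of_det45`
(p301919's Def. 4.5 (2) chain, principal tail; `hW := cotangent_hodge10_comparison_holds`, `hdetBC := det_cotangentMap_baseChange_law`,
`e := Def45.incl`, `he := Def45.coe_incl`), `complexBetti_map_mem_eigenline_transport` (`v^*` carries `τ`-eigenclasses of `i_{μ,ℂ}` to
`τ`-eigenclasses of the transported action), `HodgeCM.CM.CommonReflex.map_eigenline_complexify` (the two eigenline currencies agree under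
`β : ℂ ⊗ H¹(ℚ) ≃ H¹(ℂ)`), and §1.  HC_CM is NOT proved; `LiuCMSide`/`dLiu` themselves are port-gated.
[cite: Liu2021, Def. 4.5 (1)–(2) (FJcycle.tex ll. 1939–1951), Def. 4.3 (2) (l. 1919), §4.1 l. 1928, Prop. 4.6 (1) (l. 1969), proof of Thm. 4.18 l. 2246–2253]
[cite: Shimura1998, §5.2 (pp. 36–37), §7.1 Proposition 7 (p. 47) and §8.3 Prop. 28] [cite: MumfordAV1970, §19 Remark p. 169] -/
theorem exists_liuCMRecord_of_cmDatum
    {L : Type} [Field L] [NumberField L] [IsCMField L] [IsGalois ℚ L] (ι₁ : L →+* ℂ)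
    {μ : IdeleClassGroup L →ₜ* Circle} {hμ : IsConjugateSymplectic L μ} {hw : HasWeight L μ 1} {Car : Def45.Carriers L μ}
    (X : Def45.CMDatum (AlgHom.id ℚ L) ι₁ hμ hw Car) :
    letI := ι₁.toAlgebra
    haveI := hμ.numberField_muAlgValueField
    ∀ (α₀ : ℂ ⊗[ℚ] bettiCohomology (X.A.baseChange ℂ).X 1),
      (∀ k : muAlgValueField L μ,
        (hOneAlgHom ((AbelianVariety.endAlgebra.mapRingHom (X.A.endBaseChange ℂ)).toRingHom.comp X.i) k).baseChange ℂ α₀ =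
          ((k : muAlgValueField L μ) : ℂ) • α₀) →
      α₀ ≠ 0 →
      ∃ (B : AbelianVariety ℂ) (u : X.A.baseChange ℂ ⟶ B) (ιB : 𝓞 (muAlgValueField L μ) →+* End B)
        (θB : muAlgValueField L μ →+* Module.End ℂ (complexBetti B.X 1))
        (hB : IsCMTypeRealisation
          (inducedCMType (Def45.incl (AlgHom.id ℚ L) ι₁ hμ) (reflexCMType ι₁ hμ.cmType (AlgHom.id ℚ L))) B ιB θB)
        (α' : ℂ ⊗[ℚ] bettiCohomology B.X 1),
        AbelianVariety.IsIsogeny u ∧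
        α' ∈ eigenline (HodgeCM.CM.CommonReflex.complexify (BettiUniverse.cmAction θB hB.isInducedOnIntegers))
          (muAlgValueField L μ).subtype ∧
        α' ≠ 0 ∧
        ∀ (Y : SchemeOver ℂ) (f : Y ⟶ (X.A.baseChange ℂ).X),
          (BettiUniverse.pull (f ≫ u.hom.hom.hom) 1).baseChange ℂ α' = (BettiUniverse.pull f 1).baseChange ℂ α₀ := by
  letI := ι₁.toAlgebra
  haveI := hμ.numberField_muAlgValueField
  intro α₀ hα₀ hα₀0
  -- Def. 4.5 (2) ⇒ the principal model of `A_μ ⊗ ℂ` realises the inflated reflex type (p301919 chain, principal tail)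
  obtain ⟨B, u, v, m, hm, huv, hvu, ιB, hu, -, -, hreal⟩ :=
    exists_principal_isCMTypeRealisation_baseChange_of_det45 cotangent_hodge10_comparison_holds
      det_cotangentMap_baseChange_law ι₁ hμ X.A X.i X.finrank_eq X.det45
      (Def45.incl (AlgHom.id ℚ L) ι₁ hμ) (Def45.coe_incl (AlgHom.id ℚ L) ι₁ hμ)
  -- names
  set φ : muAlgValueField L μ →+* (X.A.baseChange ℂ).endAlgebra :=
    (AbelianVariety.endAlgebra.mapRingHom (X.A.endBaseChange ℂ)).toRingHom.comp X.i with hφ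
  set θB := complexAction ((endAlgebraTransport u v m hm huv hvu).toRingHom.comp φ) with hθB
  set τ : muAlgValueField L μ →+* ℂ := (muAlgValueField L μ).subtype with hτ
  -- Liu's class read in `H¹(A_μ(ℂ); ℂ)` is a `τ`-eigenclass of `complexAction φ`
  have hα₀' : βA (X.A.baseChange ℂ) α₀ ∈ eigenline (complexAction φ) τ := by
    rw [eigenline, Submodule.mem_iInf]
    intro k
    rw [Module.End.mem_eigenspace_iff, complexAction_βA, hα₀ k, map_smul]
    rfl
  -- its transport `v^*(β α₀)` is a `τ`-eigenclass of `θB`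
  have hvα : (complexBetti.map v.hom.hom.hom 1).hom (βA (X.A.baseChange ℂ) α₀) ∈ eigenline θB τ :=
    complexBetti_map_mem_eigenline_transport hm huv hvu φ hα₀'
  -- the record's class, in the rational-tensor currency
  let α' : ℂ ⊗[ℚ] bettiCohomology B.X 1 :=
    ((m : ℂ)⁻¹) • (BettiUniverse.pull v.hom.hom.hom 1).baseChange ℂ α₀
  have hm' : (m : ℂ) ≠ 0 := Nat.cast_ne_zero.2 hm.ne'
  -- `β_B α'` is `m⁻¹ • v^*(β_A α₀)`
  have hβα' : βA B α' = ((m : ℂ)⁻¹) • (complexBetti.map v.hom.hom.hom 1).hom (βA (X.A.baseChange ℂ) α₀) := by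
    simp only [α', map_smul]
    rw [complexBetti_map_ofRatClassBaseChangeEquiv (AbelianVariety.isSmoothProjective_holds (A := B))
      (AbelianVariety.isSmoothProjective_holds (A := X.A.baseChange ℂ)) v.hom.hom.hom α₀]
  refine ⟨B, u, ιB, θB, hreal, α', hu, ?_, ?_, fun Y f => baseChange_pull_comp_transport hm huv α₀ f⟩
  · -- `α_mem` in the `LiuCMSide` currency: through `β`, eigenlines of `complexify (cmAction θB _)` are eigenlines of `θB`
    have hmem : βA B α' ∈ eigenline θB τ := by
      rw [hβα']
      exact Submodule.smul_mem _ _ hvα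
    rw [← HodgeCM.CM.CommonReflex.map_eigenline_complexify (AbelianVariety.isSmoothProjective_holds (A := B)) θB
      hreal.isInducedOnIntegers τ, Submodule.mem_map] at hmem
    obtain ⟨t, ht, hteq⟩ := hmem
    have : t = α' := (βA B).injective hteq
    exact this ▸ ht
  · -- non-vanishing: `u^* α' = α₀ ≠ 0`
    intro h0
    apply hα₀0
    have h1 := baseChange_pull_comp_transport hm huv α₀ (𝟙 (X.A.baseChange ℂ).X)
    rw [BettiUniverse.pull_id, LinearMap.baseChange_id, LinearMap.id_apply] at h1
    rw [← h1]
    change (BettiUniverse.pull (𝟙 (X.A.baseChange ℂ).X ≫ u.hom.hom.hom) 1).baseChange ℂ α' = 0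
    rw [h0, map_zero]

end Summit.HodgeConjecture.CorCM.D2Bridge

end
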